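import Summits.HubbardSuperconductivity.HubbardSuperconductivity.Theorems.KacWindowPenaltyWindowGapPenalisedForms
import Summits.HubbardSuperconductivity.HubbardSuperconductivity.Theorems.TwTipContinuation.Negative.TipNormalForm
import Summits.HubbardSuperconductivity.HubbardSuperconductivity.Theorems.FunctionFieldCertificateMesoscopicPairOrderDanskin
import Literature.MathematicalPhysics.QuantumLattice.GriffithsLemmaGroundStates
import Literature.MathematicalPhysics.QuantumLattice.FreeFermiGasNoThermalPairFieldLRO

/-!
# Route `KacWindowPenalty` — crux `WindowGap` (stmt-HubbardSuperconductivity-1088):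
# the ORDER ∧ ROBUSTNESS split, and why its first piece is already the summit

The sufficient normal form `windowGap_of_penalisedLRO` (this directory, `…PenalisedForms`) reads
the crux as "the `d`-wave pair long-range order of the sector minimisers SURVIVES a weak Kac-window
pair repulsion". The only typed decomposition of the crux with provable glue (strategist census
`Cruxes/WindowGap/STRATEGY-CENSUS.md` §5 D2) is therefore

  (ORDER)      at some `(U, δ)` every unit sector MINIMISER `ψ` of the pure torus
               `H_L = hubbardTorus 2 L 1 U` on `K_L = szSector N_L 0` (`Re ⟨ψ, H_L ψ⟩ = minEnergyOn H_L K_L`)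
               has `l₀ L⁴ ≤ Re ⟨ψ, Δ_dᴴ Δ_d ψ⟩`, eventually in even `L`;
  (ROBUSTNESS) that floor survives, halved, in every unit minimiser of `H_L + λ W_ε` for some
               `λ = λ(ε) > 0`, for every window radius `ε > 0`;

and this module records, definition-free and with no physics:

* `isGroundStateInSector_hubbardTorus_iff_rayleigh` — for a unit vector, "sector ground state"
  (`IsGroundStateInSector`: eigenvector at the sector energy) and "sector minimiser" (membership +
  `Re ⟨ψ, H ψ⟩ = minEnergyOn`) coincide for the torus Hubbard Hamiltonian (Hermitian, sector
  preserving; `mulVec_eq_smul_of_re_rayleigh_eq_minEnergyOn` / `re_rayleigh_of_eigen_minEnergyOn`);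
* `minimiserOrder_iff_everyGSOrder` — hence (ORDER) at `(U, δ, l₀)` is the every-ground-state order
  bound of `summitMatrix_iff_everyGSOrder` verbatim;
* `minimiserOrder_iff_summitMatrix` — so (ORDER) at `(U, δ)` (for some `l₀ > 0`) is EQUIVALENT to
  the summit's conclusion at `(U, δ)` (every admissible ground-state sequence has `d`-wave
  `HasLongRangeOrder` along even sides), and `hubbardSuperconductivity_of_minimiserOrder`: (ORDER) at
  some `U > 0`, `δ ∈ (0, 1/2)` proves `HubbardSuperconductivity` outright;
* `windowGap_of_minimiserOrder_of_robust` — the glue (ORDER) → ((ORDER) → (ROBUSTNESS)) → `WindowGap`.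

Reading (census §5 D2, now a tree fact): the split is not "short of the summit" — its first piece
decides the summit statement on its own, and its second piece (the stiffness) is what separates
this crux from the summit. Supports for the crux (`--supports stmt-HubbardSuperconductivity-1088`).
H. Tasaki, *Physics and Mathematics of Quantum Many-Body Systems* (2020) §2.1 (variational
principle); S. Friedli, Y. Velenik, *Statistical Mechanics of Lattice Systems* (2017) §3.7.2
(long-range order as a liminf). No new definitions.
-/

-- the mandated namespace `Summit.<Summit>.<Problem>.Theorems` repeats `HubbardSuperconductivity`
-- (single-problem summit, D-0017), which the `dupNamespace` linter flags on every declaration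
set_option linter.dupNamespace false

namespace Summit.HubbardSuperconductivity.HubbardSuperconductivity.Theorems

open Matrix Literature.MathematicalPhysics.QuantumLattice Literature.Probability.LatticeModels
open Summit.HubbardSuperconductivity.HubbardSuperconductivity.Theses.KacWindowPenalty (WindowGap)
open Summit.HubbardSuperconductivity.TwTipContinuation.Negative (summitMatrix_iff_everyGSOrder)
open Summit.HubbardSuperconductivity.HubbardSuperconductivity.Theorems.FunctionFieldCertificate
  (mulVec_eq_smul_of_re_rayleigh_eq_minEnergyOn)

/-! ### Sector ground states = unit sector minimisers -/

/-- **Ground state ⇔ minimiser, for the torus Hubbard Hamiltonian.** For a unit Fock vector `ψ`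
and any sector `szSector N M` of the torus `(ℤ/L)²`:
`IsGroundStateInSector (hubbardTorus 2 L t U) N M ψ` (a nonzero sector eigenvector at the sector
energy) iff `ψ ∈ szSector N M` and `Re ⟨ψ, H ψ⟩ = minEnergyOn H (szSector N M)`. Forward: the
Rayleigh quotient of a unit eigenvector is its eigenvalue (`re_rayleigh_of_eigen_minEnergyOn`).
Backward: `H` is Hermitian and preserves the sector (`hubbardTorus_mulVec_mem_szSector`), so a unit
Rayleigh minimiser on it is an eigenvector (`mulVec_eq_smul_of_re_rayleigh_eq_minEnergyOn`), and a
unit vector is nonzero. Tasaki (2020) §2.1. [folklore] -/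
theorem isGroundStateInSector_hubbardTorus_iff_rayleigh {L : ℕ} [NeZero L] (t U : ℝ) (N : ℕ)
    (M : ℝ) {ψ : Fock (Orb (FermionTorus 2 L))} (hψ : star ψ ⬝ᵥ ψ = 1) :
    IsGroundStateInSector (hubbardTorus 2 L t U) N M ψ ↔
      ψ ∈ szSector (Λ := FermionTorus 2 L) N M ∧
        (star ψ ⬝ᵥ hubbardTorus 2 L t U *ᵥ ψ).re =
          (hubbardTorus 2 L t U).minEnergyOn (szSector (Λ := FermionTorus 2 L) N M) := by
  constructor
  · intro h
    exact ⟨h.1, re_rayleigh_of_eigen_minEnergyOn _ _ hψ h.2.2⟩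
  · rintro ⟨hK, hmin⟩
    have hne : ψ ≠ 0 := by
      intro h0
      rw [h0, star_zero, dotProduct_zero] at hψ
      exact zero_ne_one hψ
    exact ⟨hK, hne, mulVec_eq_smul_of_re_rayleigh_eq_minEnergyOn
      (LiebThm1.hamiltonian_isHermitian (fermionTorusGraph 2 L) t U) _
      (fun v hv => hubbardTorus_mulVec_mem_szSector t U hv) hK hψ hmin⟩

/-! ### (ORDER) is the summit's every-ground-state order bound -/

/-- **(ORDER) at `(U, δ, l₀)` ⇔ the every-ground-state order bound at `(U, δ, l₀)`.** The
minimiser form (every unit `ψ ∈ K_L` with `Re ⟨ψ, H_L ψ⟩ = minEnergyOn H_L K_L` has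
`l₀ L⁴ ≤ Re ⟨ψ, Δ_dᴴ Δ_d ψ⟩`, eventually in even `L`) and the ground-state form (every normalised
`IsGroundStateInSector` vector has the same bound) are the same statement, by
`isGroundStateInSector_hubbardTorus_iff_rayleigh` at each side `L`. Tasaki (2020) §2.1. [folklore] -/
theorem minimiserOrder_iff_everyGSOrder (U δ l₀ : ℝ) :
    (∃ L₀ : ℕ, ∀ (L : ℕ) [NeZero L], L₀ ≤ L → Even L →
        ∀ ψ : Fock (Orb (FermionTorus 2 L)), ψ ∈ szSector (2 * ⌊(1 - δ) * (L : ℝ) ^ 2 / 2⌋₊) 0 →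
          star ψ ⬝ᵥ ψ = 1 →
          (star ψ ⬝ᵥ hubbardTorus 2 L 1 U *ᵥ ψ).re =
            (hubbardTorus 2 L 1 U).minEnergyOn (szSector (2 * ⌊(1 - δ) * (L : ℝ) ^ 2 / 2⌋₊) 0) →
          l₀ * (L : ℝ) ^ 4 ≤
            (expect ((pairField dWaveFormFactor L)ᴴ * pairField dWaveFormFactor L) ψ).re) ↔
    (∃ L₀ : ℕ, ∀ (L : ℕ) [NeZero L], L₀ ≤ L → Even L →
        ∀ ψ : Fock (Orb (FermionTorus 2 L)), star ψ ⬝ᵥ ψ = 1 →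
          IsGroundStateInSector (hubbardTorus 2 L 1 U) (2 * ⌊(1 - δ) * (L : ℝ) ^ 2 / 2⌋₊) 0 ψ →
            l₀ * (L : ℝ) ^ 4 ≤
              (expect ((pairField dWaveFormFactor L)ᴴ * pairField dWaveFormFactor L) ψ).re) := by
  constructor
  · rintro ⟨L₀, h⟩
    refine ⟨L₀, fun L _ hL hE ψ hψ hgs => ?_⟩
    have h' := (isGroundStateInSector_hubbardTorus_iff_rayleigh 1 U _ 0 hψ).1 hgs
    exact h L hL hE ψ h'.1 hψ h'.2
  · rintro ⟨L₀, h⟩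
    refine ⟨L₀, fun L _ hL hE ψ hK hψ hmin => ?_⟩
    exact h L hL hE ψ hψ ((isGroundStateInSector_hubbardTorus_iff_rayleigh 1 U _ 0 hψ).2 ⟨hK, hmin⟩)

/-- **(ORDER) at `(U, δ)` ⇔ the summit's conclusion at `(U, δ)`** (`δ ≥ −1`, in particular every
hole doping `δ ∈ (0, 1/2)`): some order constant `l₀ > 0` bounds `Re ⟨ψ, Δ_dᴴ Δ_d ψ⟩ ≥ l₀ L⁴` in
every unit sector minimiser of the pure torus, eventually in even `L`, iff EVERY admissible
sequence of normalised sector ground states has `d`-wave pair-field `HasLongRangeOrder` along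
even sides — the matrix of `HubbardSuperconductivity` at `(U, δ)`. Composition of
`minimiserOrder_iff_everyGSOrder` with `summitMatrix_iff_everyGSOrder` (whose hard half is a
`Nat.findGreatest` diagonal of near-worst ground states). So the first piece of the crux's
ORDER ∧ ROBUSTNESS split is not weaker than the summit at that point: it IS the summit there.
Tasaki (2020) §2.1; Friedli–Velenik (2017) §3.7.2. [folklore] -/
theorem minimiserOrder_iff_summitMatrix {U δ : ℝ} (hδ : -1 ≤ δ) :
    (∃ l₀ : ℝ, 0 < l₀ ∧ ∃ L₀ : ℕ, ∀ (L : ℕ) [NeZero L], L₀ ≤ L → Even L →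
        ∀ ψ : Fock (Orb (FermionTorus 2 L)), ψ ∈ szSector (2 * ⌊(1 - δ) * (L : ℝ) ^ 2 / 2⌋₊) 0 →
          star ψ ⬝ᵥ ψ = 1 →
          (star ψ ⬝ᵥ hubbardTorus 2 L 1 U *ᵥ ψ).re =
            (hubbardTorus 2 L 1 U).minEnergyOn (szSector (2 * ⌊(1 - δ) * (L : ℝ) ^ 2 / 2⌋₊) 0) →
          l₀ * (L : ℝ) ^ 4 ≤
            (expect ((pairField dWaveFormFactor L)ᴴ * pairField dWaveFormFactor L) ψ).re) ↔
    (∀ (N : ℕ → ℕ) (ψ : ∀ L, Fock (Orb (FermionTorus 2 L))),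
        (∀ L, Even L → N L = 2 * ⌊(1 - δ) * (L : ℝ) ^ 2 / 2⌋₊ ∧ star (ψ L) ⬝ᵥ ψ L = 1 ∧
            IsGroundStateInSector (hubbardTorus 2 L 1 U) (N L) 0 (ψ L)) →
          HasLongRangeOrder (fun k => halfOpenBox 2 (2 * k))
            (fun k => torusPullback (pairFieldCorr dWaveFormFactor ψ) (2 * k))) := by
  rw [summitMatrix_iff_everyGSOrder hδ]
  constructor
  · rintro ⟨l₀, hl₀, h⟩
    exact ⟨l₀, hl₀, (minimiserOrder_iff_everyGSOrder U δ l₀).1 h⟩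
  · rintro ⟨c, hc, h⟩
    exact ⟨c, hc, (minimiserOrder_iff_everyGSOrder U δ c).2 h⟩

/-- **(ORDER) alone proves the summit.** If at some `U > 0`, `δ ∈ (0, 1/2)` some `l₀ > 0` bounds
`Re ⟨ψ, Δ_dᴴ Δ_d ψ⟩ ≥ l₀ L⁴` in every unit sector minimiser of the pure torus `hubbardTorus 2 L 1 U`
on `szSector N_L 0`, eventually in even `L`, then `HubbardSuperconductivity` holds
(`minimiserOrder_iff_summitMatrix`, easy half). This is why the ORDER ∧ ROBUSTNESS split of the
crux `WindowGap` hands provers the summit under a new name rather than a sub-crux.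
Tasaki (2020) §2.1; Scalapino, Phys. Rep. 250 (1995) 329, §2. [folklore] -/
theorem hubbardSuperconductivity_of_minimiserOrder
    (h : ∃ U : ℝ, 0 < U ∧ ∃ δ ∈ Set.Ioo (0 : ℝ) (1 / 2), ∃ l₀ : ℝ, 0 < l₀ ∧
      ∃ L₀ : ℕ, ∀ (L : ℕ) [NeZero L], L₀ ≤ L → Even L →
        ∀ ψ : Fock (Orb (FermionTorus 2 L)), ψ ∈ szSector (2 * ⌊(1 - δ) * (L : ℝ) ^ 2 / 2⌋₊) 0 →
          star ψ ⬝ᵥ ψ = 1 →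
          (star ψ ⬝ᵥ hubbardTorus 2 L 1 U *ᵥ ψ).re =
            (hubbardTorus 2 L 1 U).minEnergyOn (szSector (2 * ⌊(1 - δ) * (L : ℝ) ^ 2 / 2⌋₊) 0) →
          l₀ * (L : ℝ) ^ 4 ≤
            (expect ((pairField dWaveFormFactor L)ᴴ * pairField dWaveFormFactor L) ψ).re) :
    _root_.HubbardSuperconductivity := by
  obtain ⟨U, hU, δ, hδ, hord⟩ := h
  exact ⟨U, hU, δ, hδ, (minimiserOrder_iff_summitMatrix (by linarith [hδ.1])).1 hord⟩

/-! ### The glue of the split -/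

/-- **(ORDER) → ((ORDER) → (ROBUSTNESS)) → `WindowGap`.** At some `U > 0`, `δ ∈ (0, 1/2)`, `l₀ > 0`:
if every unit sector minimiser of the pure torus has `l₀ L⁴ ≤ Re ⟨ψ, Δ_dᴴ Δ_d ψ⟩` eventually in even
`L` (ORDER), and if that floor implies its own survival, halved, in every unit minimiser of the
window-penalised torus `H_L + λ W_ε` on `K_L` for some `λ = λ(ε) > 0`, for every `ε > 0`
(ROBUSTNESS — the stiffness content: "a weak Kac-window pair repulsion does not melt the
condensate"), then `WindowGap` (by `windowGap_of_penalisedLRO` with order constant `l₀/2`). With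
`hubbardSuperconductivity_of_minimiserOrder` this is the census statement that the only split with
provable glue consists of the summit and the stiffness. Tasaki (2020) §2.1. [folklore] -/
theorem windowGap_of_minimiserOrder_of_robust {U δ l₀ : ℝ} (hU : 0 < U)
    (hδ : δ ∈ Set.Ioo (0 : ℝ) (1 / 2)) (hl₀ : 0 < l₀)
    (hord : ∃ L₀ : ℕ, ∀ (L : ℕ) [NeZero L], L₀ ≤ L → Even L →
        ∀ ψ : Fock (Orb (FermionTorus 2 L)), ψ ∈ szSector (2 * ⌊(1 - δ) * (L : ℝ) ^ 2 / 2⌋₊) 0 →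
          star ψ ⬝ᵥ ψ = 1 →
          (star ψ ⬝ᵥ hubbardTorus 2 L 1 U *ᵥ ψ).re =
            (hubbardTorus 2 L 1 U).minEnergyOn (szSector (2 * ⌊(1 - δ) * (L : ℝ) ^ 2 / 2⌋₊) 0) →
          l₀ * (L : ℝ) ^ 4 ≤
            (expect ((pairField dWaveFormFactor L)ᴴ * pairField dWaveFormFactor L) ψ).re)
    (hrobust : (∃ L₀ : ℕ, ∀ (L : ℕ) [NeZero L], L₀ ≤ L → Even L →
        ∀ ψ : Fock (Orb (FermionTorus 2 L)), ψ ∈ szSector (2 * ⌊(1 - δ) * (L : ℝ) ^ 2 / 2⌋₊) 0 →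
          star ψ ⬝ᵥ ψ = 1 →
          (star ψ ⬝ᵥ hubbardTorus 2 L 1 U *ᵥ ψ).re =
            (hubbardTorus 2 L 1 U).minEnergyOn (szSector (2 * ⌊(1 - δ) * (L : ℝ) ^ 2 / 2⌋₊) 0) →
          l₀ * (L : ℝ) ^ 4 ≤
            (expect ((pairField dWaveFormFactor L)ᴴ * pairField dWaveFormFactor L) ψ).re) →
      ∀ ε : ℝ, 0 < ε → ∃ lam : ℝ, 0 < lam ∧ ∃ L₀ : ℕ, ∀ (L : ℕ) [NeZero L], L₀ ≤ L → Even L →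
        ∀ ψ : Fock (Orb (FermionTorus 2 L)), ψ ∈ szSector (2 * ⌊(1 - δ) * (L : ℝ) ^ 2 / 2⌋₊) 0 →
          star ψ ⬝ᵥ ψ = 1 →
          (star ψ ⬝ᵥ (hubbardTorus 2 L 1 U + (lam : ℂ) • (∑ m : Fin 2 → ZMod L,
              if (2 * Real.pi / (L : ℝ)) ^ 2 * (∑ i : Fin 2, (((m i).valMinAbs : ℤ) : ℝ) ^ 2) ≤ ε ^ 2
              then ((L : ℂ) ^ 2)⁻¹ • (Matrix.conjTranspose (pairFieldAt dWaveFormFactor L m) *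
                pairFieldAt dWaveFormFactor L m)
              else 0)) *ᵥ ψ).re =
            (hubbardTorus 2 L 1 U + (lam : ℂ) • (∑ m : Fin 2 → ZMod L,
              if (2 * Real.pi / (L : ℝ)) ^ 2 * (∑ i : Fin 2, (((m i).valMinAbs : ℤ) : ℝ) ^ 2) ≤ ε ^ 2
              then ((L : ℂ) ^ 2)⁻¹ • (Matrix.conjTranspose (pairFieldAt dWaveFormFactor L m) *
                pairFieldAt dWaveFormFactor L m)
              else 0)).minEnergyOn (szSector (2 * ⌊(1 - δ) * (L : ℝ) ^ 2 / 2⌋₊) 0) →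
          l₀ / 2 * (L : ℝ) ^ 4 ≤
            (expect ((pairField dWaveFormFactor L)ᴴ * pairField dWaveFormFactor L) ψ).re) :
    WindowGap :=
  windowGap_of_penalisedLRO ⟨U, hU, δ, hδ, l₀ / 2, half_pos hl₀, hrobust hord⟩

end Summit.HubbardSuperconductivity.HubbardSuperconductivity.Theorems
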